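import Summits.KontsevichZagierPeriods.KontsevichZagierPeriods.Theorems.RootDecompQuadraticDescentPair18HomotopyAngP17

/-! # `RootDecompQuadraticDescentPair18HomotopyAngP18` — part 18/20 of the mechanical ≤400-line split of `Pair18HomotopyAng_v13_landing.lean` (sha256 01bf0af4c8d09f43…)
Source: decomp-kz lens-6 g9 `Pair18HomotopyAng.lean` v13 (HOME/decomp-kz-lens-6/g9/, sha256 bd7fcda1…; critic g5 19:35:56Z CLEARED «angle side of #18 PROVED»: hTh7_holds, hB17_holds, hAng4_holds with no hypotheses) — companion file #2 of Pair18Homotopy v14 (landed as …Pair18HomotopyP01–P31): the verbatim COPIED PRELUDE is dropped in favour of those landed declarations, the four homonyms with different bodies are renamed (Th7_eq', TriA, isSemialgebraic_TriA, volume_diag'), `#print axioms` pins removed.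
Split by census-1 g9 `gen/splitlean.py`: scopes re-opened with their `open`/`variable`/`set_option` context; mathematics and declaration order unchanged. -/

set_option linter.unusedSimpArgs false
noncomputable section
open _root_.Set MvPolynomial
namespace Summit.KontsevichZagierPeriods.RootDecompQuadraticDescent.Pair18Homotopy
open Literature.NumberTheory.Transcendental
open Literature.NumberTheory.Transcendental.KZ (RFun cube)
open Summit.KontsevichZagierPeriods.RootDecompQuadraticDescent.DarkPairs (rel_reflect_rep rel_double)
section Fold
open Literature.ModelTheory.ExponentialFields (IsSemialgebraic isSemialgebraic_setOf_eval_le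
  isSemialgebraic_setOf_eval_pos isSemialgebraic_setOf_eval_nonneg isSemialgebraic_setOf_eval_eq_zero)

open _root_.Set MvPolynomial in
open Literature.NumberTheory.Transcendental in
open Literature.NumberTheory.Transcendental.KZ (RFun cube) in
open Summit.KontsevichZagierPeriods.RootDecompQuadraticDescent.DarkPairs (rel_reflect_rep rel_double) in
/-- Auxiliary step `vec2_1` (§2b): vec2 1. [bookkeeping] -/
private theorem vec2_1 (a b : ℝ) : (![a, b] : Fin 2 → ℝ) 1 = b := rfl

open _root_.Set MvPolynomial in
open Literature.NumberTheory.Transcendental in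
open Literature.NumberTheory.Transcendental.KZ (RFun cube) in
open Summit.KontsevichZagierPeriods.RootDecompQuadraticDescent.DarkPairs (rel_reflect_rep rel_double) in
/-- Auxiliary step `vec2_0` (§2b): vec2 0. [bookkeeping] -/
private theorem vec2_0 (a b : ℝ) : (![a, b] : Fin 2 → ℝ) 0 = a := rfl

open _root_.Set MvPolynomial in
open Literature.NumberTheory.Transcendental in
open Literature.NumberTheory.Transcendental.KZ (RFun cube) in
open Summit.KontsevichZagierPeriods.RootDecompQuadraticDescent.DarkPairs (rel_reflect_rep rel_double) in
/-- Auxiliary step `cube2` (§0): cube2. [bookkeeping] -/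
private theorem cube2 {x : Fin 2 → ℝ} (hx : x ∈ KZ.cube 2) : (0 ≤ x 0 ∧ x 0 ≤ 1) ∧ (0 ≤ x 1 ∧ x 1 ≤ 1) := ⟨hx 0, hx 1⟩

/-- `[W₇|C₁] ≡ [W₇|Row1]` and `[W₇|C2c] ≡ [W₇|C2cT]` (swaps). -/
theorem W7C1_Row1 : KZ.of W7C1 - KZ.of W7Row1 ∈ KZ.relations := by
  refine W7_swap isSemialgebraic_C1 isSemialgebraic_Row1 (fun _ hz => hz.1) (fun _ hz => hz.1)
    (fun z hz => ?_) (fun w hw => ?_)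
  · obtain ⟨hcu, x7⟩ := hz
    have h0 := (cube2 hcu).1
    have h1 := (cube2 hcu).2
    simp only [sX7, mem_setOf_eq] at x7
    refine ⟨?_, ?_⟩
    · intro i
      fin_cases i
      · exact h1
      · exact h0
    · simp only [sY7, mem_setOf_eq, Sw_one]; exact x7
  · obtain ⟨hcu, y7⟩ := hw
    have h0 := (cube2 hcu).1
    have h1 := (cube2 hcu).2
    simp only [sY7, mem_setOf_eq] at y7
    refine ⟨?_, ?_⟩
    · intro i
      fin_cases i
      · exact h1
      · exact h0
    · simp only [sX7, mem_setOf_eq, Sw_zero]; exact y7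
/-- Auxiliary step `W7C2c_C2cT`: W7 C2c C2c T. [bookkeeping] -/
theorem W7C2c_C2cT : KZ.of W7C2c - KZ.of W7C2cT ∈ KZ.relations := by
  refine W7_swap isSemialgebraic_C2c isSemialgebraic_C2cT (fun _ hz => hz.1) (fun _ hz => hz.1)
    (fun z hz => ?_) (fun w hw => ?_)
  · obtain ⟨hcu, ⟨⟨⟨x7c, x3⟩, y7c⟩, y3c⟩⟩ := hz
    have h0 := (cube2 hcu).1
    have h1 := (cube2 hcu).2
    simp only [sX7c, sX3, sY7c, sY3c, mem_setOf_eq] at x7c x3 y7c y3c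
    refine ⟨?_, ⟨⟨⟨?_, ?_⟩, ?_⟩, ?_⟩⟩
    · intro i
      fin_cases i
      · exact h1
      · exact h0
    · simp only [sY7c, mem_setOf_eq, Sw_one]; exact x7c
    · simp only [sY73, mem_setOf_eq, Sw_one]; exact x3
    · simp only [sX7c, mem_setOf_eq, Sw_zero]; linarith
    · simp only [sX3c, mem_setOf_eq, Sw_zero]; exact y3c
  · obtain ⟨hcu, ⟨⟨⟨y7c, y73⟩, x7c⟩, x3c⟩⟩ := hw
    have h0 := (cube2 hcu).1
    have h1 := (cube2 hcu).2
    simp only [sX7c, sX3c, sY7c, sY73, mem_setOf_eq] at x7c x3c y7c y73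
    refine ⟨?_, ⟨⟨⟨?_, ?_⟩, ?_⟩, ?_⟩⟩
    · intro i
      fin_cases i
      · exact h1
      · exact h0
    · simp only [sX7c, mem_setOf_eq, Sw_zero]; exact y7c
    · simp only [sX3, mem_setOf_eq, Sw_zero]; exact y73
    · simp only [sY7c, mem_setOf_eq, Sw_one]; linarith
    · simp only [sY3c, mem_setOf_eq, Sw_one]; exact x3c

/-- **The 9-cell dissection**: `[W₇|[0,1]²] ≡ 4•[W7Sq17] + 4•[W7R0x] + [W7Bx]` (`θ² = (2α₁+β)²`). -/
theorem W7cube_dissection :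
    KZ.of W7cube - 4 • KZ.of W7Sq17 - 4 • KZ.of W7R0x - KZ.of W7Bx ∈ KZ.relations := by
  have hcol : KZ.of W7C1 - 2 • KZ.of W7Sq17 - KZ.of W7R0x ∈ KZ.relations := by
    have h := add_mem (add_mem (add_mem W7C1_Row1 W7Row1_cut) W7Row1b_cut) W7Row1c_Sq17
    convert h using 1
    abel
  have hmid : KZ.of W7C2 - 2 • KZ.of W7R0x - KZ.of W7Bx ∈ KZ.relations := by
    have h := add_mem (add_mem (add_mem (add_mem W7C2_cut W7C2b_cut) W7C2c_C2cT) W7C2cT_R0xT) W7R0xT_R0x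
    convert h using 1
    abel
  have h := add_mem (add_mem (add_mem (add_mem W7cube_cut W7C23_cut) W7C3_C1) (AddSubgroup.nsmul_mem _ hcol 2))
    hmid
  convert h using 1
  simp only [smul_sub, smul_smul]
  norm_num
  abel

/-- **hAng4 ⟸ X0.**  The entire angle side of #18 follows from the two cube→chart statements
`[Th7] ≡ [W₇|[0,1]²]` and `[B17] ≡ [W₇|[0,1/7]²]` (`Th7 = B(7)`, `B17 = B(1/7)` the cube reps of file #1;
§9.20 steps 1–2: fibre cov `t = u², v = ub` + symmetrisation, and for `B17` the scaling `x = 7x'`). -/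
theorem hAng4_of_X0 (hTh7 : KZ.of Th7.rep - KZ.of W7cube ∈ KZ.relations)
    (hB17 : KZ.of B17.rep - KZ.of W7Sq17 ∈ KZ.relations) :
    KZ.of AngHM + KZ.of AngHp + KZ.of AngHm - KZ.of Th7.rep + 2 • KZ.of B17.rep ∈ KZ.relations := by
  refine hAng4_of_lattice6 ?_
  have h := add_mem (sub_mem (neg_mem W7cube_dissection) hTh7) (AddSubgroup.nsmul_mem _ hB17 2)
  convert h using 1
  simp only [smul_sub]
  abel

/-! ### §19u  hTh7 — `[Th7] ≡ [W₇|[0,1]²]` (cube→chart): `Bq_Bbox` (y = v², copied from file #1 with `rel_sq`,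
`rel_swap`, `rel_restrict_null`), the fibre cov `t = v·b` onto the triangle minus a null edge, doubling, diagonal cut, swap. -/

-- verbatim copies from file #1 (Pair18Homotopy.lean v14)

/-- Auxiliary step `h7q` (§19u): h7q. [bookkeeping] -/
private theorem h7q : (0:ℚ) ≤ 7 := by norm_num
/-- Auxiliary step `Th7_eq'` (§19u): Th7 eq'. [bookkeeping] -/
theorem Th7_eq' : Th7.rep = (Bbox 7 h7q).rep := rfl

/-- `2·W₇`. -/
def W14 : RFun 2 := ⟨C 14, W7Den, fun x _ => (W7Den_pos x).ne'⟩
/-- Auxiliary definition `sPos0` (§19u): s Pos0. [bookkeeping] -/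
def sPos0 : Set (Fin 2 → ℝ) := {z | 0 < z 0}
/-- Auxiliary step `isSemialgebraic_sPos0` (§19u): is Semialgebraic s Pos0. [bookkeeping] -/
theorem isSemialgebraic_sPos0 : IsSemialgebraic ℚ sPos0 := by
  have h := isSemialgebraic_setOf_eval_pos (R := ℝ) (X 0 : MvPolynomial (Fin 2) ℚ)
  have e : {x : Fin 2 → ℝ | 0 < aeval x (X 0 : MvPolynomial (Fin 2) ℚ)} = sPos0 := by
    ext z; simp only [mem_setOf_eq, aeval_X, sPos0]
  rw [e] at h; exact h
/-- Auxiliary definition `sDiag` (§19u): s Diag. [bookkeeping] -/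
def sDiag : Set (Fin 2 → ℝ) := {z | z 1 - z 0 ≤ 0}
/-- Auxiliary definition `sDiagU` (§19u): s Diag U. [bookkeeping] -/
def sDiagU : Set (Fin 2 → ℝ) := {z | 0 ≤ z 1 - z 0}
/-- Auxiliary step `isSemialgebraic_sDiag` (§19u): is Semialgebraic s Diag. [bookkeeping] -/
theorem isSemialgebraic_sDiag : IsSemialgebraic ℚ sDiag :=
  isSemialgebraic_of_le (X 1 - X 0) (C 0) sDiag fun z => by
    simp only [sDiag, mem_setOf_eq, map_sub, aeval_C, aeval_X, eq_ratCast, Rat.cast_zero]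
/-- Auxiliary step `isSemialgebraic_sDiagU` (§19u): is Semialgebraic s Diag U. [bookkeeping] -/
theorem isSemialgebraic_sDiagU : IsSemialgebraic ℚ sDiagU :=
  isSemialgebraic_of_le (C 0) (X 1 - X 0) sDiagU fun z => by
    simp only [sDiagU, mem_setOf_eq, map_sub, aeval_C, aeval_X, eq_ratCast, Rat.cast_zero]
/-- Auxiliary definition `SqP0` (§19u): Sq P0. [bookkeeping] -/
def SqP0 : Set (Fin 2 → ℝ) := cube 2 ∩ sPos0
/-- Auxiliary definition `TriA` (§19u): Tri A. [bookkeeping] -/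
def TriA : Set (Fin 2 → ℝ) := cube 2 ∩ sDiag
/-- Auxiliary definition `TriUp` (§19u): Tri Up. [bookkeeping] -/
def TriUp : Set (Fin 2 → ℝ) := cube 2 ∩ sDiagU
/-- Auxiliary definition `TriP` (§19u): Tri P. [bookkeeping] -/
def TriP : Set (Fin 2 → ℝ) := TriA ∩ sPos0
/-- Auxiliary step `isSemialgebraic_SqP0` (§19u): is Semialgebraic Sq P0. [bookkeeping] -/
theorem isSemialgebraic_SqP0 : IsSemialgebraic ℚ SqP0 := KZ.isSemialgebraic_cube.inter isSemialgebraic_sPos0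
/-- Auxiliary step `isSemialgebraic_TriA` (§19u): is Semialgebraic Tri A. [bookkeeping] -/
theorem isSemialgebraic_TriA : IsSemialgebraic ℚ TriA := KZ.isSemialgebraic_cube.inter isSemialgebraic_sDiag
/-- Auxiliary step `isSemialgebraic_TriUp` (§19u): is Semialgebraic Tri Up. [bookkeeping] -/
theorem isSemialgebraic_TriUp : IsSemialgebraic ℚ TriUp := KZ.isSemialgebraic_cube.inter isSemialgebraic_sDiagU
/-- Auxiliary step `isSemialgebraic_TriP` (§19u): is Semialgebraic Tri P. [bookkeeping] -/
theorem isSemialgebraic_TriP : IsSemialgebraic ℚ TriP := isSemialgebraic_TriA.inter isSemialgebraic_sPos0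
/-- Auxiliary definition `BqP` (§19u): Bq P. [bookkeeping] -/
def BqP : KZ.IntegralRep 2 := (Bq 7 h7q).rep.restrict SqP0 isSemialgebraic_SqP0 (fun _ hz => hz.1)
/-- Auxiliary definition `W14Tri` (§19u): W14 Tri. [bookkeeping] -/
def W14Tri : KZ.IntegralRep 2 := W14.rep.restrict TriA isSemialgebraic_TriA (fun _ hz => hz.1)
/-- Auxiliary definition `W14TriP` (§19u): W14 Tri P. [bookkeeping] -/
def W14TriP : KZ.IntegralRep 2 := W14Tri.restrict TriP isSemialgebraic_TriP (fun _ hz => hz.1)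
/-- Auxiliary definition `W7Tri` (§19u): W7 Tri. [bookkeeping] -/
def W7Tri : KZ.IntegralRep 2 := W7.rep.restrict TriA isSemialgebraic_TriA (fun _ hz => hz.1)
/-- Auxiliary definition `W7TriUp` (§19u): W7 Tri Up. [bookkeeping] -/
def W7TriUp : KZ.IntegralRep 2 := W7.rep.restrict TriUp isSemialgebraic_TriUp (fun _ hz => hz.1)

/-- Auxiliary step `volume_edge0` (§19u): volume edge0. [bookkeeping] -/
private theorem volume_edge0 : MeasureTheory.volume {z : Fin 2 → ℝ | z 0 = 0} = 0 := by
  have h := volume_setOf_aeval_eq_zero (k := ℚ) (m := 2) (X 0 : MvPolynomial (Fin 2) ℚ) (by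
    rw [MvPolynomial.map_X]; exact MvPolynomial.X_ne_zero 0)
  have e : {x : Fin 2 → ℝ | aeval x (X 0 : MvPolynomial (Fin 2) ℚ) = 0} = {z | z 0 = 0} := by
    ext z; simp only [mem_setOf_eq, aeval_X]
  rw [e] at h; exact h
/-- Auxiliary step `volume_diag'` (§19u): volume diag'. [bookkeeping] -/
theorem volume_diag' : MeasureTheory.volume {z : Fin 2 → ℝ | z 1 - z 0 = 0} = 0 := by
  have h := volume_setOf_aeval_eq_zero (k := ℚ) (m := 2) (X 1 - X 0 : MvPolynomial (Fin 2) ℚ) (by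
    intro h0
    have h1 := congr_arg (MvPolynomial.eval ![(0:ℝ), 1]) h0
    simp at h1)
  have e : {x : Fin 2 → ℝ | aeval x (X 1 - X 0 : MvPolynomial (Fin 2) ℚ) = 0} = {z | z 1 - z 0 = 0} := by
    ext z; simp only [mem_setOf_eq, map_sub, aeval_X]
  rw [e] at h; exact h

/-- remove the null edge `v = 0`. -/
theorem Bq7_P : KZ.of (Bq 7 h7q).rep - KZ.of BqP ∈ KZ.relations := by
  refine rel_restrict_null (Bq 7 h7q).rep SqP0 isSemialgebraic_SqP0 (fun _ hz => hz.1)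
    (MeasureTheory.measure_mono_null (fun z hz => ?_) volume_edge0)
  obtain ⟨hzc, hzn⟩ := hz
  have hzc' : z ∈ cube 2 := hzc
  have h0 := (cube2 hzc').1
  simp only [mem_setOf_eq]
  by_contra hne
  exact hzn ⟨hzc', lt_of_le_of_ne h0.1 (Ne.symm hne)⟩
/-- Auxiliary step `W14Tri_P` (§19u): W14 Tri P. [bookkeeping] -/
theorem W14Tri_P : KZ.of W14Tri - KZ.of W14TriP ∈ KZ.relations := by
  refine rel_restrict_null W14Tri TriP isSemialgebraic_TriP (fun _ hz => hz.1)
    (MeasureTheory.measure_mono_null (fun z hz => ?_) volume_edge0)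
  obtain ⟨hzc, hzn⟩ := hz
  have hzc' : z ∈ TriA := hzc
  have h0 := (cube2 hzc'.1).1
  simp only [mem_setOf_eq]
  by_contra hne
  exact hzn ⟨hzc', lt_of_le_of_ne h0.1 (Ne.symm hne)⟩

/-- the fibre scaling `(v, b) ↦ (v, v·b)`. -/
def Fib (z : Fin 2 → ℝ) : Fin 2 → ℝ := ![z 0, z 0 * z 1]
/-- Auxiliary step `Fib_zero` (§19u): Fib zero. [bookkeeping] -/
theorem Fib_zero (z : Fin 2 → ℝ) : Fib z 0 = z 0 := rfl
/-- Auxiliary step `Fib_one` (§19u): Fib one. [bookkeeping] -/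
theorem Fib_one (z : Fin 2 → ℝ) : Fib z 1 = z 0 * z 1 := rfl

set_option maxHeartbeats 800000 in
/-- **the fibre cov**: `[Bq 7 | v > 0] ≡ [2W₇ | 0 ≤ t ≤ v, v > 0]`. -/
theorem BqP_cov : KZ.of BqP - KZ.of W14TriP ∈ KZ.relations := by
  let Mz : (Fin 2 → ℝ) → Matrix (Fin 2) (Fin 2) ℝ := fun z => !![1, 0; z 1, z 0]
  let Φ' : (Fin 2 → ℝ) → (Fin 2 → ℝ) →L[ℝ] (Fin 2 → ℝ) := fun z =>
    LinearMap.toContinuousLinearMap (Matrix.toLin' (Mz z))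
  have hΦ'ap : ∀ z w, Φ' z w = ![w 0, z 1 * w 0 + z 0 * w 1] := by
    intro z w; funext i
    fin_cases i <;> simp [Φ', Mz, Matrix.toLin'_apply, Matrix.mulVec, dotProduct, Fin.sum_univ_two]
  have hdet : ∀ z, (Φ' z).det = z 0 := by
    intro z
    unfold ContinuousLinearMap.det
    simp [Φ', LinearMap.det_toLin', Mz, Matrix.det_fin_two]
  have hdom : W14TriP.domain = Fib '' BqP.domain := by
    simp only [W14TriP, BqP, KZ.IntegralRep.domain_restrict]
    ext w
    constructor
    · rintro ⟨⟨hwc, hle⟩, hpos⟩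
      have h0 := (cube2 hwc).1
      have h1 := (cube2 hwc).2
      have hle' : w 1 - w 0 ≤ 0 := hle
      have hpos' : 0 < w 0 := hpos
      refine ⟨![w 0, w 1 / w 0], ⟨?_, ?_⟩, ?_⟩
      · intro i
        fin_cases i
        · exact h0
        · show 0 ≤ w 1 / w 0 ∧ w 1 / w 0 ≤ 1
          exact ⟨div_nonneg h1.1 h0.1, by rw [div_le_one hpos']; linarith⟩
      · show (0:ℝ) < w 0
        exact hpos'
      · funext i
        fin_cases i
        · rfl
        · show w 0 * (w 1 / w 0) = w 1
          field_simp
    · rintro ⟨z, ⟨hzc, hpos⟩, rfl⟩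
      have h0 := (cube2 hzc).1
      have h1 := (cube2 hzc).2
      have hpos' : 0 < z 0 := hpos
      refine ⟨⟨?_, ?_⟩, ?_⟩
      · intro i
        fin_cases i
        · exact h0
        · show 0 ≤ z 0 * z 1 ∧ z 0 * z 1 ≤ 1
          exact ⟨mul_nonneg h0.1 h1.1, by nlinarith⟩
      · show z 0 * z 1 - z 0 ≤ 0
        nlinarith
      · show (0:ℝ) < z 0
        exact hpos'
  refine KZ.changeOfVariablesRel_subset_relations ⟨2, BqP, W14TriP, Fib, Φ', ?_, ?_, ?_, hdom, ?_, rfl⟩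
  · have hsd : IsSemialgebraic ℚ BqP.domain := BqP.isSemialgebraic_domain
    refine (isSemialgebraicMapOn_iff_forall_holds hsd).mpr fun i => ?_
    fin_cases i
    · exact (isSemialgebraicFunOn_aeval hsd (X 0)).congr fun z _ => by
        simp only [Fib, Fin.zero_eta, Matrix.cons_val_zero, aeval_X]
    · exact (isSemialgebraicFunOn_aeval hsd (X 0 * X 1)).congr fun z _ => by
        simp only [Fib, Fin.mk_one, Matrix.cons_val_one, Matrix.head_cons, Matrix.cons_val_fin_one, map_mul,
          aeval_X]
  · intro z hz
    have hA := hasFDerivAt_apply (𝕜 := ℝ) 0 z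
    have hB := hasFDerivAt_apply (𝕜 := ℝ) 1 z
    have h01 := hA.mul hB
    have hpi : HasFDerivAt Fib (Φ' z) z := by
      rw [hasFDerivAt_pi']
      intro i
      fin_cases i
      · refine (hA.congr_fderiv ?_).congr_of_eventuallyEq (Filter.Eventually.of_forall fun y => ?_)
        · ext w
          simp [hΦ'ap]
        · simp only [Fin.zero_eta, Fib_zero]
      · refine (h01.congr_fderiv ?_).congr_of_eventuallyEq (Filter.Eventually.of_forall fun y => ?_)
        · ext w
          simp [hΦ'ap]
          ring
        · simp only [Fin.mk_one, Fib_one, Pi.mul_apply]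
    exact hpi.hasFDerivWithinAt
  · intro z₁ hz₁ z₂ hz₂ heq
    have hz₁' : z₁ ∈ SqP0 := by simpa [BqP, KZ.IntegralRep.domain_restrict] using hz₁
    have hpos : 0 < z₁ 0 := hz₁'.2
    have e0 : z₁ 0 = z₂ 0 := by simpa [Fib] using congrFun heq 0
    have e1 : z₁ 0 * z₁ 1 = z₂ 0 * z₂ 1 := by simpa [Fib] using congrFun heq 1
    rw [← e0] at e1
    have e1' := mul_left_cancel₀ hpos.ne' e1
    funext i
    fin_cases i
    · exact e0
    · exact e1'
  · intro z hz
    have hz' : z ∈ SqP0 := by simpa [BqP, KZ.IntegralRep.domain_restrict] using hz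
    have h0 := (cube2 hz'.1).1
    have h1 := (cube2 hz'.1).2
    have hpos : 0 < z 0 := hz'.2
    rw [hdet z, abs_of_pos hpos]
    simp only [BqP, W14TriP, W14Tri, KZ.IntegralRep.integrand_restrict, RFun.rep_integrand]
    simp only [Bq, BqDen, W14, W7Den, RFun.fn, Fib, map_add, map_sub, map_mul, aeval_C, aeval_X, eq_ratCast,
      Rat.cast_one, Rat.cast_ofNat, Rat.cast_mul, vec2_0, vec2_1, Matrix.cons_val_zero, Matrix.cons_val_one,
      Matrix.head_cons]
    have ha : (0:ℝ) < 1 + 7 * z 0 * z 0 := by nlinarith [mul_nonneg h0.1 h0.1]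
    have hb : (0:ℝ) < 1 + 7 * z 0 * z 0 * z 1 * z 1 := by
      nlinarith [mul_nonneg (mul_nonneg h0.1 h0.1) (mul_nonneg h1.1 h1.1)]
    have hc : (0:ℝ) < 1 + 7 * (z 0 * z 1) * (z 0 * z 1) := by nlinarith [mul_self_nonneg (z 0 * z 1)]
    have hane := ha.ne'
    have hbne := hb.ne'
    have hcne := hc.ne'
    field_simp
    ring

end Fold
end Summit.KontsevichZagierPeriods.RootDecompQuadraticDescent.Pair18Homotopy
end
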